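import Mathlib.AlgebraicGeometry.Morphisms.Proper
import Mathlib.AlgebraicGeometry.Morphisms.Separated
import Mathlib.AlgebraicGeometry.Morphisms.FiniteType
import Mathlib.AlgebraicGeometry.FunctionField
import Mathlib.RingTheory.Derivation.Basic
import Mathlib.RingTheory.KrullDimension.Basic
import Mathlib.FieldTheory.IsAlgClosed.Basic
import Mathlib.Algebra.CharP.Defs
import Mathlib.Topology.KrullDimension
import Literature.AlgebraicGeometry.Resolution.ResolutionOfSingularities
import Literature.AlgebraicGeometry.CossartPiltant200819.Thm21Verbatim2008
import HarnessLib

/-!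
# Cossart's normal form of a function on a regular threefold over an algebraically closed field of positive characteristic (Cossart 1987)

**LITERATURE-DRAFT KIT (lens 5, res-B-lens-5 g11; crux workfile on stmt-ResolutionOfSingularities-0549, counted 0).**  This file is the
porter's copy for INPUTS' F-112 keying condition (a) «the literal fact typed as ONE cite-tagged def under
`Literature/AlgebraicGeometry/Resolution/`».  PORTER: (1) target path `Literature/AlgebraicGeometry/Resolution/CossartFunctionNormalForm3.lean`
(suggested; twin of `GiraudFunctionNormalForm.lean`); (2) replace the `namespace … .LiteratureDraft` line and its `end` by
`namespace Literature.AlgebraicGeometry.Resolution` / `end Literature.AlgebraicGeometry.Resolution`; (3) delete this paragraph.  The two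
declarations below are BYTE-IDENTICAL to `NuZeroAt` (§5) and `Cossart1987Thm` (§7, rev 9) of `Cruxes/DescentPerfectToAll/Lens5_KbarCossartAnchor.lean`
(rev 9), whose §10 proves `Cossart1987Thm → Cossart1987NuZeroAlongValuationAt p` and whose consumer-by-name is
`cleanLU3Defect_algClosed_of_cossart1987Thm (p) (h : Cossart1987Thm)`.  Imports: Mathlib + `Literature.….ResolutionOfSingularities`
(for `Scheme.IsRegular`) only.  Nothing here proves resolution in characteristic `p`; resolution in char `p` is NOT proved.

Topic: `Literature/AlgebraicGeometry/Resolution`.  V. Cossart, *Forme normale d'une fonction sur un k-schéma de dimension 3 et de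
caractéristique p > 0*, in: Géométrie algébrique et applications, I (La Rábida, 1984), Travaux en Cours 22, Hermann, Paris (1987) 1–21
[Cossart1987] (= the published form of part of the thèse d'État, Orsay 1987); restated, with an overview of the definitions and of the
algorithm «following the referees' suggestion», in Q. Posva, *Resolution of 1-foliation singularities on surfaces and threefolds*,
arXiv:2405.05735 (2024), Appendix A «Globalization of Cossart's algorithm» [Posva2024] — the HELD text from which this file is typed
(PDF pp. 32–33 of the materialised `paper-arxiv-2405.05735`):

* A.1 (p.32): «Let `k` be an algebraically closed field of characteristic `p > 0`, and `X` be a regular variety of dimension three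
  over `k`. We fix a global function `f ∈ H⁰(X, 𝒪_X)` which is not a `p`-th power.»
* A.1.1 (p.32): for an snc reduced divisor `E` on `X`, `D(X, E) : U ↦ {∂ ∈ Der(𝒪_X)(U) | ∂(I_{E∩U}) ⊆ I_{E∩U}}` and the ideal sheaf
  `𝒥(X, f, E) = im[D(X, E) —ev_f→ 𝒪_X]`; «By [Cos87b, Proposition I.A.2] there is a unique way of writing `𝒥(X, f, E) = H(X, f, E) · J(X, f, E)`
  where … `H(X, f, E)` is the ideal of a snc divisor whose support is contained in `E`, and for every generic point `η` of `E` we have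
  `H(X, f, E)_η = 𝒥(X, f, E)_η`»; `ν(x) = ord_x J(X, f, E)`.
* A.1.2 (p.32): a *modification* of `(X, E)` = a finite sequence of blow-ups `X(i+1) → X(i)` in regular closed subschemes
  `Y(i) ⊂ Sing(X(i), f, E(i))` having normal crossings with `E(i)`, `E(i+1) = red(π(i)⁻¹(E(i) ∪ Y(i)))` snc, `f` pulled back.
* A.1.3 Goal (p.33): «Cossart proves the following: if `dim X = 3`, there exists a modification `X(n)` of `(X, f, ∅)` such that
  `J(X(n), f, E(n)) = 𝒪_{X(n)}`. Equivalently, we eventually have `ν(X(n)) = 0`.»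

This file states, as one DEFINITION and one NAMED FACT (no proof is attempted — Cossart's algorithm is [Cos87b] Chap. II, some sixty
pages; Posva App. A pp. 32–34 summarises it):

* `NuZeroAt f` — «`ν(x) = 0` for `(f, E)`» at the local ring `S = 𝒪_{X,x}`: for some regular system of parameters `t` of `S`
  (`d = dim S`) whose first `e` members cut out the components of the snc boundary `E` through `x` (for such `E`, `∂(I_E) ⊆ I_E` iff
  `t_i ∣ ∂ t_i` for every `i < e`), the ideal generated by the values `D f` of the derivations `D` of `S` logarithmic along `E` is the
  principal monomial ideal `(∏_{i<e} t_i^{b_i})` — i.e. `𝒥(X, f, E)_x` EQUALS its divisorial part `H(X, f, E)_x`, `J_x = 𝒪_{X,x}`.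
* `Cossart1987Thm` — NAMED FACT, A.1 + A.1.3: for `X` integral, quasi-compact, separated, locally of finite type AND QUASI-PROJECTIVE
  (`CP2008.IsQuasiProjectiveOver sX`, the tree's verbatim idiom of CP 2008 Thm 2.1 — Posva §2.1 (a): «variety» = integral quasi-projective
  `k`-scheme of finite type) over an algebraically closed field `k` of characteristic `p`, regular of dimension `3`, and `f ∈ Γ(X, 𝒪_X)` not a `p`-th power, there is a
  proper `π : X' → X`, an isomorphism over a non-empty open, with `X'` integral and regular, such that `NuZeroAt` holds for the
  pull-back of `f` at EVERY point of `X'`.  Users take `(h : Cossart1987Thm)`.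

## Rendering choices (what is weaker / stronger than print, deliberately)

* Derivations are taken over `ℤ` (`Derivation ℤ S S`): over a perfect (here algebraically closed) ground field every derivation kills
  `k = k^p`, so `Der_ℤ = Der_k` on the local rings in question; the stalk of the subsheaf `D(X, E) ⊆ Der_k(𝒪_X)` (coherent for `X` of
  finite type) at `x` is the module of derivations of `𝒪_{X,x}` logarithmic along the germ of `E`.
* «regular variety over `k`» is read as: integral, separated, locally of finite type and quasi-compact (`CompactSpace X`, which for a
  morphism to `Spec k` is `QuasiCompact`), every local ring regular (`Scheme.IsRegular`), `topologicalKrullDim X = 3`.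
* «not a `p`-th power» is read in the function field `K(X)` (for a normal integral `X` the same as in `H⁰(X, 𝒪_X)`; as a HYPOTHESIS the
  function-field reading is the stronger one, so the fact as typed is implied by print).
* The conclusion «a modification `X(n)` with `J(X(n), f, E(n)) = 𝒪`» is flattened to its standard consequences, exactly as in the
  tree's `Giraud1983Thm24`: `π` proper (a composite of blow-ups), an isomorphism over a non-empty open (the centres lie in
  `Sing(X(i), f, E(i)) ≠ X(i)`), `X'` integral and regular (blow-ups of a regular scheme in regular centres), and at every point `x'`
  the POINTWISE statement `NuZeroAt` w.r.t. SOME snc germ through `x'` (print: w.r.t. the germ of `E(n)`) — weaker than print and all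
  that the consumers use (the Zariski-local read-off «`ν = 0` ⇒ loosely clean», kernel-proved over every ground field in
  `Lens5_KbarCossartAnchor.lean` §8–§9 / `Lens5_KbarReadOff.lean`).
`-- TODO(general form): the conclusion as a modification in Cossart's sense (a CentreSeq of permissible blow-ups carrying E(n)).`
-/

noncomputable section

set_option linter.dupNamespace false -- (Cruxes workfile namespace; PORTER: delete this line)

open IsLocalRing CategoryTheory AlgebraicGeometry TopologicalSpace
open Literature.AlgebraicGeometry.Resolution

/- PORTER: `namespace Literature.AlgebraicGeometry.Resolution` -/
namespace Summit.ResolutionOfSingularities.ResolutionOfSingularities.Cruxes.DescentPerfectToAll.CpSibling.KbarAnchor.LiteratureDraft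

/-- **`ν(x) = 0` for `(f, E)` at the local ring `S = 𝒪_{X,x}`** ([Cossart1987]; [Posva2024] App. A §A.1.1 and §A.1.3 «`J(X(n), f, E(n)) =
𝒪_{X(n)}`» read at a point): for some regular system of parameters `t` of `S` (`d = dim S`) whose first `e` members cut out the snc
boundary `E` through `x`, the ideal generated by the values `D f` of the derivations `D ∈ Der_ℤ(S)` logarithmic along `E`
(`t_i ∣ D t_i`, `i < e`) is the principal monomial ideal `(∏_{i<e} t_i^{b_i})` (the log-Jacobian ideal equals its divisorial part).
[cite: Posva2024, App. A §A.1.1 and §A.1.3; Cossart1987, Introduction] -/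
def NuZeroAt {S : Type} [CommRing S] [IsLocalRing S] (f : S) : Prop :=
  ∃ (d e : ℕ) (hed : e ≤ d) (t : Fin d → S) (b : Fin e → ℕ),
    Ideal.span (Set.range t) = maximalIdeal S ∧ ringKrullDim S = (d : WithBot ℕ∞) ∧
    Ideal.span {v : S | ∃ D : Derivation ℤ S S,
        (∀ i : Fin e, t (Fin.castLE hed i) ∣ D (t (Fin.castLE hed i))) ∧ D f = v} =
      Ideal.span {∏ i : Fin e, t (Fin.castLE hed i) ^ b i}

/-- NAMED FACT — **Cossart 1987** ([Cossart1987] main theorem; [Posva2024] App. A §A.1 «`k` algebraically closed of characteristic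
`p > 0`, `X` a regular variety of dimension three over `k`, `f ∈ H⁰(X, 𝒪_X)` not a `p`-th power» and §A.1.3 «there exists a modification
`X(n)` of `(X, f, ∅)` such that `J(X(n), f, E(n)) = 𝒪_{X(n)}`. Equivalently, we eventually have `ν(X(n)) = 0`»; §2.1 (a) p.5: «variety» = integral quasi-projective `k`-scheme of finite type): `X` an
integral quasi-compact regular scheme of dimension `3`, separated, locally of finite type and quasi-projective (`CP2008.IsQuasiProjectiveOver`,
`Thm21Verbatim2008.lean`; affine f.t. schemes qualify by `CP2008.isQuasiProjectiveOver_of_isAffine`) over an algebraically closed field `k` of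
characteristic `p`; `f ∈ Γ(X, 𝒪_X)` not a `p`-th power in `K(X)`; conclusion: a proper `π : X' → X`, an isomorphism over a non-empty open, `X'` integral
and regular, such that `NuZeroAt` holds for the pull-back of `f` at EVERY point of `X'`.  Users take `(h : Cossart1987Thm)`.
`-- TODO(general form): conclusion as a CentreSeq of permissible blow-ups with its snc boundary E(n).`
[cite: Cossart1987, main theorem; Posva2024, App. A §A.1 and §A.1.3] -/
def Cossart1987Thm : Prop :=
  ∀ (p : ℕ) [Fact p.Prime] (k : Type) [Field k] [CharP k p] [IsAlgClosed k]
    (X : Scheme.{0}) [IsIntegral X] [CompactSpace X] (sX : X ⟶ Spec (CommRingCat.of k))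
    [LocallyOfFiniteType sX] [IsSeparated sX],
    Literature.AlgebraicGeometry.CossartPiltant200819.CP2008.IsQuasiProjectiveOver sX →
    Scheme.IsRegular X → topologicalKrullDim X = 3 →
    ∀ f : Γ(X, ⊤), (∀ c : X.functionField, c ^ p ≠ (X.presheaf.germ ⊤ (genericPoint X) trivial) f) →
    ∃ (X' : Scheme.{0}) (π : X' ⟶ X), IsProper π ∧ IsIntegral X' ∧ Scheme.IsRegular X' ∧
      (∃ U : X.Opens, (U : Set X).Nonempty ∧ IsIso (π ∣_ U)) ∧
      ∀ x' : X', NuZeroAt ((X'.presheaf.germ ⊤ x' trivial) (π.appTop f))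

end Summit.ResolutionOfSingularities.ResolutionOfSingularities.Cruxes.DescentPerfectToAll.CpSibling.KbarAnchor.LiteratureDraft
/- PORTER: `end Literature.AlgebraicGeometry.Resolution` -/

end
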